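import Summits.ABC.IUTFork.Joshi.TestHarnessSeparation
import Summits.ABC.IUTFork.Joshi.TestFundamentalEstimateIndependence
import Summits.ABC.IUTFork.Joshi.TestIsmScalingResults
import HarnessLib

/-!
# Test artefact (c8): the LICENCE / STATEMENT square — S and the typed Corollary 3.12 Statement are logically independent
# over the cell's models, and S ⟹ Statement along the frozen-print family

AUTHORED BY abc-iut-E-cx (refuter seat, block-E adversary); proxy-filed VERBATIM by a prover seat (gate rule `theorems.refuter`).

Bookkeeping theorem for block E's OUTCOME line (TEST-LEDGER §3, X-06 / X-07′ / VT rows), proof-only, no new `def`.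
With S = `Cor312Vol.PilotKummerIndRelated` (the licence no clause of the typed [IUTchIII] Thm. 3.11 provides) and
St = `Cor312.Setting.Statement` (Cor. 3.12 as typed), every model below satisfies the typed Thm. 3.11 (i)–(iii)
(`FullSituation.Statement`), `|log(q)| > 0` and all three pins (`PinnedRegions3`):

* `licence_statement_square` — all four corners are INHABITED:
  S ∧ St at the Θ-valued q-datum `e = (1,4)` (abc-iut-E-t4 `expMochizuki_*`, p429995);
  S ∧ ¬St at abc-iut-E-t41's ism-enlarged `IsmScaling.scalSetting` (p431886 — the ONLY kind of inhabitant the cell has, R17: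
  the (Ind2)-enlargement is [J-I]-licensed, the identification with [IUTchIII]'s (Ind2) is Joshi's own disputed dictionary);
  ¬S ∧ St at `e = (2,4)` (abc-iut-E-cx `*_expTwoFour`, p429673); ¬S ∧ ¬St at the pinned countermodel of record (c312-3).
* `expSetting_pilotKummerIndRelated_iff` / `expSetting_statement_of_pilotKummerIndRelated` — along the FROZEN-PRINT exponent
  family (Ism = {±1}, q-datum `{(±q^{e_j})_j}`): S ⟺ `e = (1,4)` ⟹ `esum e = 5` ⟹ St. So with Mochizuki's printed indeterminacies
  S is STRONGER than the typed Statement along this family and the converse fails (`expSetting_statement_and_not_pilotKummerIndRelated`: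
  St ∧ ¬S whenever `esum e ≥ 5`, `e ≠ (1,4)`); the corner S ∧ ¬St needs the ism enlargement (X-07′).

Interface/toy level. The campaign LOCATES; it takes no side on [IUTchIII] Cor. 3.12, on [Joshi2024ATS3], or on any author;
typed ≠ proved ≠ endorsed. References: [IUTchIII] = Mochizuki, *IUT III*, Cor. 3.12, Thm. 3.11, Rem. 3.11.1, 3.12.2 (ii);
[SS2018] = Scholze–Stix, *Why abc is still a conjecture*, §2.2 pp. 9–10; [Joshi2024ATS3] = arXiv:2303.01662v4, §6.10, App. II.5.
-/

open Set

namespace Summit.ABC.IUTFork.Joshi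

open Thm311 Cor312 Cor312Vol Cor312.Checks Cor312.IdentifiedNonVacuity Literature.IUT.LogThetaLattice
open PinnedWitness NaiveWitness GluedMonoids.Naive

section LicenceSquare

variable (p : ℕ) [hp : Fact p.Prime] (e : toyIndex.LabelStar → ℕ)

/-- **Along the frozen-print exponent family, S ⟺ `e = (1, 4)`** (S ⟺ Reading R3 under the pins and Thm 3.11 (ii)(b),
c312-1 `reading3_iff_pilotKummerIndRelated`; R3 ⟺ `e = (1,4)`, `expSetting_reading3_iff'`). [claim: Mochizuki2012, status: disputed] -/
theorem expSetting_pilotKummerIndRelated_iff :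
    PilotKummerIndRelated (naiveFull p).toLatticeSituation (expSetting p e) (ballOfMonoid p) (fun v _ => qDatumExp p e v) ↔
      e ⟨1, by decide⟩ = 1 ∧ e ⟨2, by decide⟩ = 4 :=
  (reading3_iff_pilotKummerIndRelated (naiveFull p).toLatticeSituation (expSetting p e) (ballOfMonoid p)
    (fun v _ => qDatumExp p e v) (naive_partII p (expSetting p e).n).2.1 (expSetting_pinnedRegions p e)).symm.trans
    (expSetting_reading3_iff' p e)

/-- **Along the frozen-print family, S IMPLIES the typed Statement** (`e = (1,4)` ⟹ `esum e = 5 ≥ 5`,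
`expSetting_statement_iff`). With Mochizuki's printed indeterminacies (Ism = {±1}) the licence is the STRONGER condition here.
[folklore] -/
theorem expSetting_statement_of_pilotKummerIndRelated
    (h : PilotKummerIndRelated (naiveFull p).toLatticeSituation (expSetting p e) (ballOfMonoid p) fun v _ => qDatumExp p e v) :
    (expSetting p e).Statement := by
  obtain ⟨h1, h2⟩ := (expSetting_pilotKummerIndRelated_iff p e).1 h
  rw [expSetting_statement_iff]
  simp [esum, h1, h2]

/-- … and the converse FAILS on the whole half-family `esum e ≥ 5`, `e ≠ (1,4)`: the typed Statement holds while S fails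
(e.g. `e = (2,4)`, `(2,3)`, `(3,3)`). [folklore] -/
theorem expSetting_statement_and_not_pilotKummerIndRelated (h5 : 5 ≤ esum e)
    (hne : ¬ (e ⟨1, by decide⟩ = 1 ∧ e ⟨2, by decide⟩ = 4)) :
    (expSetting p e).Statement ∧
      ¬ PilotKummerIndRelated (naiveFull p).toLatticeSituation (expSetting p e) (ballOfMonoid p) fun v _ => qDatumExp p e v :=
  ⟨(expSetting_statement_iff p e).2 h5, fun h => hne ((expSetting_pilotKummerIndRelated_iff p e).1 h)⟩

end LicenceSquare

section Square

/-- **THE LICENCE / STATEMENT SQUARE — `licence_statement_square`.** Over models satisfying the typed Theorem 3.11 (i)–(iii),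
`|log(q)| > 0` and all three pins, ALL FOUR corners of (S, Statement-as-typed) are inhabited: S ∧ St (Θ-valued q-datum
`e = (1,4)`, p429995) · S ∧ ¬St (abc-iut-E-t41's ism-enlarged `scalSetting`, p431886 — R17: a Joshi-side instantiation) ·
¬S ∧ St (`e = (2,4)`, p429673) · ¬S ∧ ¬St (the pinned countermodel of record). Hence neither of S, St implies the other over the
cell's models; block E's trichotomy (X-06 isometric Ism ⟹ ¬S-by-moves · X-07′ rescaling Ism ⟹ S ∧ −|log Θ| = ⊤ · Joshi's own
volume computation bypasses S) is the finer statement. Interface/toy level; no judgement on print or preprint. [folklore] -/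
theorem licence_statement_square :
    (∃ (T : ThetaIndex) (F : FullSituation T) (P : Setting F.toLatticeSituation.toSituation)
        (ρ : (∀ v : T.V, v ∈ T.Vbad → Set (F.L.StarPacket v)) → ∀ (j : T.Label) (vQ : T.VQ), Set (F.L.Packet j vQ))
        (qK : ∀ v : T.V, v ∈ T.Vbad → Set (F.L.StarPacket v)),
        F.Statement ∧ P.AbsLogQPos ∧ PinnedRegions3 F.toLatticeSituation P ρ qK ∧
          PilotKummerIndRelated F.toLatticeSituation P ρ qK ∧ P.Statement) ∧
    (∃ (T : ThetaIndex) (F : FullSituation T) (P : Setting F.toLatticeSituation.toSituation)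
        (ρ : (∀ v : T.V, v ∈ T.Vbad → Set (F.L.StarPacket v)) → ∀ (j : T.Label) (vQ : T.VQ), Set (F.L.Packet j vQ))
        (qK : ∀ v : T.V, v ∈ T.Vbad → Set (F.L.StarPacket v)),
        F.Statement ∧ P.AbsLogQPos ∧ PinnedRegions3 F.toLatticeSituation P ρ qK ∧
          PilotKummerIndRelated F.toLatticeSituation P ρ qK ∧ ¬ P.Statement) ∧
    (∃ (T : ThetaIndex) (F : FullSituation T) (P : Setting F.toLatticeSituation.toSituation)
        (ρ : (∀ v : T.V, v ∈ T.Vbad → Set (F.L.StarPacket v)) → ∀ (j : T.Label) (vQ : T.VQ), Set (F.L.Packet j vQ))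
        (qK : ∀ v : T.V, v ∈ T.Vbad → Set (F.L.StarPacket v)),
        F.Statement ∧ P.AbsLogQPos ∧ PinnedRegions3 F.toLatticeSituation P ρ qK ∧
          ¬ PilotKummerIndRelated F.toLatticeSituation P ρ qK ∧ P.Statement) ∧
    (∃ (T : ThetaIndex) (F : FullSituation T) (P : Setting F.toLatticeSituation.toSituation)
        (ρ : (∀ v : T.V, v ∈ T.Vbad → Set (F.L.StarPacket v)) → ∀ (j : T.Label) (vQ : T.VQ), Set (F.L.Packet j vQ))
        (qK : ∀ v : T.V, v ∈ T.Vbad → Set (F.L.StarPacket v)),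
        F.Statement ∧ P.AbsLogQPos ∧ PinnedRegions3 F.toLatticeSituation P ρ qK ∧
          ¬ PilotKummerIndRelated F.toLatticeSituation P ρ qK ∧ ¬ P.Statement) := by
  haveI : Fact (Nat.Prime 2) := ⟨Nat.prime_two⟩
  refine ⟨⟨toyIndex, naiveFull 2, expSetting 2 expMochizuki, ballOfMonoid 2, fun v _ => qDatumExp 2 expMochizuki v,
      naiveFull_statement 2, expSetting_absLogQPos 2 _ (by decide), expSetting_pinnedRegions3 2 _,
      expMochizuki_pilotKummerIndRelated 2, expMochizuki_statement 2⟩,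
    ⟨toyIndex, IsmScaling.scalFull 2, IsmScaling.scalSetting 2, IsmScaling.scalRegion 2, PinnedWitness.qDatum 2,
      IsmScaling.scalFull_statement 2, IsmScaling.scalSetting_absLogQPos 2, IsmScaling.scalSetting_pinnedRegions3 2,
      IsmScaling.scalSetting_pilotKummerIndRelated 2, (IsmScaling.scalSetting_not_statement_not_bridgeHyps 2).1⟩,
    ⟨toyIndex, naiveFull 2, expSetting 2 expTwoFour, ballOfMonoid 2, fun v _ => qDatumExp 2 expTwoFour v,
      naiveFull_statement 2, absLogQPos_expTwoFour 2, expSetting_pinnedRegions3 2 _,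
      not_pilotKummerIndRelated_expTwoFour 2, statement_expTwoFour 2⟩,
    ⟨toyIndex, naiveFull 2, pinnedSetting 2, orbitRegion 2, PinnedWitness.qDatum 2,
      naiveFull_statement 2, pinnedSetting_absLogQPos 2, pinnedSetting_pinnedRegions3 2,
      pinnedSetting_not_pilotKummerIndRelated 2, pinnedSetting_not_statement 2⟩⟩

end Square

end Summit.ABC.IUTFork.Joshi
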